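import Summits.SmoothPoincare4.SmoothPoincare4.Theorems.ConvexBisectionContractibleTwistedDoubleStandardStubSeam
import Summits.SmoothPoincare4.SmoothPoincare4.Theorems.ContractibleTwistedDoubleStandard.Negative.LoadBearing
import Literature.Geometry.Symplectic.SteinFillingSphere
import Literature.Geometry.Symplectic.SteinFillingSphereMorseReduction
import Literature.Geometry.Symplectic.SteinDomainShrinking
import Literature.Topology.FourManifolds.MorseAffine
import Literature.Topology.FourManifolds.CerfGammaFour
import Literature.Topology.FourManifolds.CerfGammaFourProofs
import Literature.Topology.FourManifolds.TwistedSpheres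
import Literature.Topology.FourManifolds.CorkDecomposition
import Literature.Topology.FourManifolds.ClosedBall
import Mathlib.Geometry.Manifold.Diffeomorph

/-!
# Stub `stub_ballHalfSmooth` of line `property-r-mazur-halves` for crux `ConvexBisection.ContractibleTwistedDoubleStandard`
(item stmt-SmoothPoincare4-3546, route route-SmoothPoincare4-ConvexBisection, skeleton m4 "smooth sectors")

The **ball sector in smooth form** of the crux: a closed `4`-manifold `X = e₁(W₁) ∪ e₂(W₂)`
covered by two smoothly embedded compact contractible Stein domains meeting exactly along both
boundary images, with matched complex tangencies, is `S⁴` as soon as the first half `W₁` carries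
SOME Morse function adapted to the boundary (`Literature.Topology.FourManifolds.IsMorseAdapted`:
Morse, `≡ 1` and regular on `∂W₁`, `< 1` inside; Milnor 1965, Def. 3.1) with at most one
critical point — CONDITIONALLY on the two named facts of the tree which the skeleton files as a
separate fact-stub and feeds in as leading hypotheses:

* `Literature.Geometry.Symplectic.Eliashberg1990_steinFilling_sphere_three` (Eliashberg 1990,
  Thm. 5.1: a compact Stein domain bounded by `S³` is `𝔻⁴`);
* `Literature.Topology.FourManifolds.cerf_twistedSphere_four` (Cerf 1968, `Γ₄ = 0`: every twisted
  sphere `𝔻⁴ ∪_φ 𝔻⁴` is `S⁴`).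

This is the smooth variant of the landed `stub_ballHalf`
(`ConvexBisectionContractibleTwistedDoubleStandardStubBallHalf.lean`), where the Morse function
was the `J`-convex function `J₁.φ` itself; steps (3)–(5) below are copied from it.

Proof.  (1) `f` attains its minimum at some `p` (compact, nonempty since contractible).  The
interior of `W₁` is nonempty — the minimum `q` of the `J`-convex function `J₁.φ` is an interior
point, for otherwise `φ` is constant and `dφ = 0` on `∂W₁ = {φ = max φ} ≠ ∅`, against the
regularity axiom of a Stein structure — and `f q < 1` there while `f = 1` on `∂W₁`; so the
minimum `p` of `f` is an interior point, hence a critical point (Fermat), hence THE critical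
point.  (2) `W₁ ≅ 𝔻⁴` by Milnor's disc theorem
(`Literature.Geometry.Symplectic.nonempty_diffeomorph_closedBall_of_isMorseAdapted_of_isLocalMin`,
Milnor 1963, Thm. 3.1 with Lemma 2.2).  (3) The seam map `ψ : ∂W₁ ≅ ∂W₂` of the LANDED stub
`stub_seam` and the boundary restriction `∂Φ₁ : ∂W₁ ≅ S³` show `∂W₂ ≅ S³`, so `W₂ ≅ 𝔻⁴` by
Eliashberg.  (4) `X` is the boundary gluing `W₁ ∪_ψ W₂` (pieces `e₁`, `e₂`; the seam equations
say that `e₁ a = e₂ a'` exactly when `a = incl₁ z`, `a' = incl₂ (ψ z)`).  (5) Transporting the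
gluing along `Φ₁⁻¹ : 𝔻⁴ ≅ W₁` and `Φ₂⁻¹ : 𝔻⁴ ≅ W₂`
(`Literature.Topology.FourManifolds.IsBoundaryGluing.transfer`) exhibits `X` as a twisted sphere
`𝔻⁴ ∪_χ 𝔻⁴`, `χ = ∂Φ₂⁻¹ ≫ ψ⁻¹ ≫ ∂Φ₁ ∈ Diff(S³)`, and Cerf concludes.  Contractibility of `W₁`
enters only through nonemptiness; that of `W₂` and the Stein structure `J₁` beyond the location
of the boundary are not used otherwise.
-/

noncomputable section

-- the prescribed namespace `Summit.<P>.<Sub>.…` duplicates `SmoothPoincare4` (P = Sub)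
set_option linter.dupNamespace false

open scoped Manifold ContDiff Topology
open Set Function Literature.Topology.FourManifolds Literature.Geometry.Symplectic

namespace Summit.SmoothPoincare4.SmoothPoincare4.Theorems.ContractibleTwistedDoubleStandard.PropertyRMazurHalves

/-! ### A Stein domain carrying an adapted Morse function with at most one critical point is a `4`-ball -/

/-- **The minimum of the `J`-convex function of a nonempty Stein domain is an interior point**
(equivalently, lies below the maximum): otherwise `φ` is constant, so `dφ = 0` at the minimum,
which is then a boundary point (`SteinStructure.boundary_eq`) where `dφ ≠ 0`
(`SteinStructure.regular`).  Gompf, *Handlebody construction of Stein surfaces* (1998), §1 (the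
boundary of a Stein domain is the regular maximal level set). [folklore] -/
private theorem isInteriorPoint_of_isMinOn_φ {W : Type*} [TopologicalSpace W]
    [ChartedSpace (EuclideanHalfSpace 4) W] [IsManifold (𝓡∂ 4) ∞ W] [CompactSpace W]
    (S : SteinStructure W) {p : W} (hp : IsMinOn S.φ univ p) :
    (𝓡∂ 4).IsInteriorPoint p := by
  refine (S.isInteriorPoint_iff_φ_lt p).2 ?_
  by_contra hge
  have hpeq : S.φ p = sSup (range S.φ) := le_antisymm (S.φ_le_sSup p) (not_lt.1 hge)
  have hconst : ∀ y, S.φ y = sSup (range S.φ) := fun y =>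
    le_antisymm (S.φ_le_sSup y) (hpeq.ge.trans (hp (mem_univ y)))
  have hpb : (𝓡∂ 4).IsBoundaryPoint p := (S.boundary_eq p).2 hpeq
  refine S.regular p hpb ?_
  have hfun : S.φ = fun _ => sSup (range S.φ) := funext hconst
  rw [hfun]
  exact mfderiv_const

/-- **A compact nonempty Stein domain carrying a Morse function adapted to the boundary with at
most one critical point is diffeomorphic to `𝔻⁴`.**  The interior of `W` is nonempty (the minimum
of `φ` lies in it, `isInteriorPoint_of_isMinOn_φ`) and `f < 1` there while `f = 1` on `∂W`
(Milnor 1965, Def. 3.1), so the minimum `p` of `f` is an interior point, hence a critical point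
(Fermat, `isMCriticalPt_of_isLocalMin`), hence the only one, an interior local minimum; Milnor's
disc theorem (`nonempty_diffeomorph_closedBall_of_isMorseAdapted_of_isLocalMin`) gives `W ≅ 𝔻⁴`.
[cite: Milnor1963, Thm. 3.1 and Lemma 2.2] -/
private theorem nonempty_diffeomorph_closedBall_of_isMorseAdapted_of_subsingleton
    {W : Type*} [TopologicalSpace W] [T2Space W] [ChartedSpace (EuclideanHalfSpace 4) W]
    [IsManifold (𝓡∂ 4) ∞ W] [CompactSpace W] [Nonempty W] (S : SteinStructure W)
    {f : W → ℝ} (hf : IsMorseAdapted (𝓡∂ 4) f) (hsub : (criticalSet (𝓡∂ 4) f).Subsingleton) :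
    Nonempty (W ≃ₘ⟮𝓡∂ 4, 𝓡∂ 4⟯ Metric.closedBall (0 : EuclideanSpace ℝ (Fin 4)) 1) := by
  -- an interior point `q`, where `f q < 1`
  obtain ⟨q, -, hq⟩ :=
    isCompact_univ.exists_isMinOn univ_nonempty S.φ_smooth.continuous.continuousOn
  have hqi : (𝓡∂ 4).IsInteriorPoint q := isInteriorPoint_of_isMinOn_φ S hq
  have hfq : f q < 1 := hf.2.2 q hqi
  -- the minimum `p` of `f` is an interior point, hence the unique critical point
  obtain ⟨p, -, hp⟩ :=
    isCompact_univ.exists_isMinOn univ_nonempty hf.isMorse.contMDiff.continuous.continuousOn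
  have hpq : f p ≤ f q := hp (mem_univ q)
  have hpi : (𝓡∂ 4).IsInteriorPoint p := by
    rcases (𝓡∂ 4).isInteriorPoint_or_isBoundaryPoint p with hpi | hpb
    · exact hpi
    · exact absurd ((hf.2.1 p hpb).1 ▸ hpq) (not_le.2 hfq)
  have hplocal : IsLocalMin f p := hp.isLocalMin Filter.univ_mem
  have hpcrit : IsMCriticalPt (𝓡∂ 4) f p := isMCriticalPt_of_isLocalMin hplocal hpi
  have huniq : ∀ x, IsMCriticalPt (𝓡∂ 4) f x → x = p := fun x hx => hsub hx hpcrit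
  exact nonempty_diffeomorph_closedBall_of_isMorseAdapted_of_isLocalMin hf hplocal hpi huniq

/-! ### The stub -/

/-- **Stub `stub_ballHalfSmooth` (ball sector, smooth form; conditional on Eliashberg 1990
Thm. 5.1 and Cerf 1968 `Γ₄ = 0`).**  In a Stein bisection `X = e₁(W₁) ∪ e₂(W₂)` of a closed
`4`-manifold by two compact contractible Stein domains meeting exactly along both boundary images
with matched complex tangencies, if `W₁` carries a Morse function adapted to the boundary with at
most one critical point then `X ≅ S⁴`: `W₁ ≅ 𝔻⁴` by Milnor's disc theorem
(`nonempty_diffeomorph_closedBall_of_isMorseAdapted_of_subsingleton`); the seam diffeomorphism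
`ψ : ∂W₁ ≅ ∂W₂` of the landed stub `stub_seam` and `∂Φ₁ : ∂W₁ ≅ S³`
(`BoundaryData.restrictDiffeomorph`) make `(W₂, J₂)` a Stein filling of `S³`, hence `W₂ ≅ 𝔻⁴`
(hypothesis `Eliashberg1990_steinFilling_sphere_three`); `X = W₁ ∪_ψ W₂` is a boundary gluing
(pieces `e₁`, `e₂`, seam equations), which transported along `Φ₁⁻¹`, `Φ₂⁻¹`
(`IsBoundaryGluing.transfer`) is a twisted sphere `𝔻⁴ ∪_χ 𝔻⁴`, hence `≅ S⁴` (hypothesis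
`cerf_twistedSphere_four`).  Kervaire–Milnor (1963), §1; Cerf (1968); Eliashberg (1990), Thm. 5.1;
Milnor (1963), Thm. 3.1. [folklore] -/
theorem stub_ballHalfSmooth :
    Eliashberg1990_steinFilling_sphere_three → cerf_twistedSphere_four →
    ∀ (X : Type) [TopologicalSpace X] [T2Space X] [SecondCountableTopology X] [CompactSpace X]
      [ChartedSpace (EuclideanSpace ℝ (Fin 4)) X] [IsManifold (𝓡 4) ∞ X]
      (W₁ : Type) [TopologicalSpace W₁] [ChartedSpace (EuclideanHalfSpace 4) W₁]
      [IsManifold (𝓡∂ 4) ∞ W₁] [CompactSpace W₁] [ContractibleSpace W₁]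
      (W₂ : Type) [TopologicalSpace W₂] [ChartedSpace (EuclideanHalfSpace 4) W₂]
      [IsManifold (𝓡∂ 4) ∞ W₂] [CompactSpace W₂] [ContractibleSpace W₂]
      (J₁ : SteinStructure W₁) (J₂ : SteinStructure W₂) (e₁ : W₁ → X) (e₂ : W₂ → X),
      Manifold.IsSmoothEmbedding (𝓡∂ 4) (𝓡 4) ∞ e₁ → Manifold.IsSmoothEmbedding (𝓡∂ 4) (𝓡 4) ∞ e₂ →
      Set.range e₁ ∪ Set.range e₂ = Set.univ →
      Set.range e₁ ∩ Set.range e₂ = e₁ '' (𝓡∂ 4).boundary W₁ →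
      Set.range e₁ ∩ Set.range e₂ = e₂ '' (𝓡∂ 4).boundary W₂ →
      (∀ w₁ w₂, e₁ w₁ = e₂ w₂ →
        Submodule.map (mfderiv (𝓡∂ 4) (𝓡 4) e₁ w₁).toLinearMap (contactPlane J₁.J w₁) =
          Submodule.map (mfderiv (𝓡∂ 4) (𝓡 4) e₂ w₂).toLinearMap (contactPlane J₂.J w₂)) →
      ∀ (f : W₁ → ℝ), IsMorseAdapted (𝓡∂ 4) f → (criticalSet (𝓡∂ 4) f).Subsingleton →
      Nonempty (X ≃ₘ⟮𝓡 4, 𝓡 4⟯ Metric.sphere (0 : EuclideanSpace ℝ (Fin 5)) 1) := by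
  intro hE hCerf X _ _ _ _ _ _ W₁ _ _ _ _ _ W₂ _ _ _ _ _ J₁ J₂ e₁ e₂ h1 h2 hcov hL hR hC f hf hsub
  -- the halves are Hausdorff and second countable (embedded in `X`), `W₁` is nonempty
  haveI : T2Space W₁ := h1.isEmbedding.t2Space
  haveI : T2Space W₂ := h2.isEmbedding.t2Space
  haveI : SecondCountableTopology W₁ := h1.isEmbedding.secondCountableTopology
  haveI : SecondCountableTopology W₂ := h2.isEmbedding.secondCountableTopology
  -- (1)+(2) the first half is a ball
  obtain ⟨Φ₁⟩ := nonempty_diffeomorph_closedBall_of_isMorseAdapted_of_subsingleton J₁ hf hsub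
  -- (3) boundary data, the seam diffeomorphism, and the second half is a ball (Eliashberg)
  obtain ⟨b₁⟩ : Nonempty (BoundaryData (𝓡∂ 4) W₁ (𝓡 3)) := nonempty_boundaryData_holds 3 W₁
  obtain ⟨b₂⟩ : Nonempty (BoundaryData (𝓡∂ 4) W₂ (𝓡 3)) := nonempty_boundaryData_holds 3 W₂
  obtain ⟨ψ, hψ, -⟩ :=
    LegendrianRKnotRigidity.stub_seam X W₁ W₂ J₁ J₂ e₁ e₂ h1 h2 hL hR hC b₁ b₂
  let D : BoundaryData (𝓡∂ 4) (Metric.closedBall (0 : EuclideanSpace ℝ (Fin 4)) 1) (𝓡 3) :=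
    closedBallBoundaryData 3
  obtain ⟨Φ₂⟩ := hE.of_steinStructure J₂ b₂ (ψ.symm.trans (b₁.restrictDiffeomorph D Φ₁))
  -- (4) `X = W₁ ∪_ψ W₂`
  have hglue : IsBoundaryGluing b₁ b₂ ψ (𝓡 4) X := by
    refine ⟨e₁, e₂, h1, h2, hcov, fun a a' => ⟨fun h => ?_, ?_⟩⟩
    · obtain ⟨hb, -⟩ := Negative.seam_mem_boundary h1 h2 hL hR h
      have ha : a ∈ range b₁.incl := by rw [b₁.range_incl]; exact hb
      obtain ⟨z, rfl⟩ := ha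
      refine ⟨z, rfl, h2.isEmbedding.injective ?_⟩
      rw [hψ z]
      exact h.symm
    · rintro ⟨z, rfl, rfl⟩
      exact (hψ z).symm
  -- (5) transport to the two balls: `X = 𝔻⁴ ∪_χ 𝔻⁴`
  have hT₁ : IsBoundaryGluing D b₂ (ψ ∘ D.restrictDiffeomorph b₁ Φ₁.symm) (𝓡 4) X :=
    IsBoundaryGluing.transfer (b₁ := D) Φ₁.symm hglue
  have hT₁' : IsBoundaryGluing D b₂ ⇑((D.restrictDiffeomorph b₁ Φ₁.symm).trans ψ) (𝓡 4) X := hT₁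
  have hT₂ : IsBoundaryGluing D D
      (⇑((D.restrictDiffeomorph b₁ Φ₁.symm).trans ψ).symm ∘ D.restrictDiffeomorph b₂ Φ₂.symm)
      (𝓡 4) X :=
    IsBoundaryGluing.transfer (b₁ := D) Φ₂.symm hT₁'.symm'
  let χ : (Metric.sphere (0 : EuclideanSpace ℝ (Fin 4)) 1) ≃ₘ⟮𝓡 3, 𝓡 3⟯
      (Metric.sphere (0 : EuclideanSpace ℝ (Fin 4)) 1) :=
    (D.restrictDiffeomorph b₂ Φ₂.symm).trans ((D.restrictDiffeomorph b₁ Φ₁.symm).trans ψ).symm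
  have hX : IsTwistedSphere 3 χ X := hT₂
  let T : TwistedSphere 3 χ := { carrier := X, isTwistedSphere := hX }
  exact hCerf χ T

end Summit.SmoothPoincare4.SmoothPoincare4.Theorems.ContractibleTwistedDoubleStandard.PropertyRMazurHalves

end
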